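import Summits.BirchSwinnertonDyer.BirchSwinnertonDyer.Theorems.GenusKolyvaginAtTwoGenusPrimitiveSupplyAtTwoTwoTranspositionSupply
import Summits.BirchSwinnertonDyer.BirchSwinnertonDyer.Theorems.GenusKolyvaginAtTwoGenusPrimitiveSupplyAtTwoTranspositionSelmerTrivialTwin
import Summits.BirchSwinnertonDyer.BirchSwinnertonDyer.Theorems.GenusKolyvaginAtTwoGenusPrimitiveSupplyAtTwoPrimeHeegnerTwinSilentPrimes
import Summits.BirchSwinnertonDyer.BirchSwinnertonDyer.Theorems.GenusKolyvaginAtTwoGenusPrimitiveSupplyAtTwoArchimedeanRowsHold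
import Summits.BirchSwinnertonDyer.BirchSwinnertonDyer.Theorems.ByReductionTypeAtTwoRankOneAtTwoOneDoorLawDefs
import HarnessLib

/-!
# Route `GenusKolyvaginAtTwo`, crux #2 `GenusPrimitiveSupplyAtTwo` (stmt-BirchSwinnertonDyer-22136):
# THE DOOR SUPPLY ON THE SLICE `{Ш(W)[2] = 0, Δ ∉ ℚ²}` — every rank-one `W` with `E(ℚ)[2] = 0` on that slice has a door-admissible
# Heegner field with a `Sel₂`-TRIVIAL twist (`RankOneAtTwoOneDoor.DoorSupplyAtTwo` restricted to the slice), by the three doors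

Width seat `bsd-line-gk2-p4` g15 (cell `bsd-f1-sign2`), sequel of `…TranspositionSelmerTrivialTwin` (the `Δ < 0` transposition door,
`exists_transpAdmissible_door_twistSelmerTwoCard_eq_one`, g13/g14), `…PrimeHeegnerTwinSilentPrimes` + `…ArchimedeanRowsHold` (gk2-p5 / this lineage g12:
silent prime Heegner fields and T-C `eggTwistLawAtTwo_holds`, the `ε = +1` descent door) and `…TwoTranspositionSupply` (AN-26S, the `ε = −1`
two-transposition door, this generation). THEOREMS ONLY (no definition, no named fact, no `sorry`); helper `--supports stmt-BirchSwinnertonDyer-22136`;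
no item is closed; BSD is not proved by any of this.

WHAT.
* §40 `doorAdmissible_of_transpAdmissible`, `doorAdmissible_of_descAdmissible`, `doorAdmissible_of_twoTranspAdmissible` — the three door
  parameters of the cell are door-admissible in the sense of the fkl line (`RankOneAtTwoOneDoor.DoorAdmissible`: any number of good door primes).
* §41 **`exists_doorAdmissible_twistSelmerTwoCard_eq_one`** — for `W/ℚ` globally minimal elliptic with `Δ_W ∉ ℚ²`, `E(ℚ)[2] = 0`, Mordell–Weil rank `1`
  and `Ш(W)[2] = 0` there is an imaginary quadratic `K` with `d_K` door-admissible, `Sel₂(W^{(d_K)}) = 0`, `(d_K, N_W) = 1` and the Heegner hypothesis —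
  i.e. the conclusion of `RankOneAtTwoOneDoor.DoorSupplyAtTwo` on the slice `{Ш[2] = 0, Δ ∉ ℚ²}` (the big-image slice of crux `RankOneAtTwoBigImageOddLocal`).
  Three doors: `Δ < 0` — one transposition prime, door open (g13/g14); `Δ > 0`, `ε = +1` (`MeetsEgg`) — a silent prime `ℓ ≡ 7 (8)` (gk2-p5) and T-C;
  `Δ > 0`, `ε = −1` — two transposition primes (AN-26S). `doorSupplyAtTwo_on_slice` restates it in the binder order of `DoorSupplyAtTwo`.

Honest framing: KNOWN in print (Mazur–Rubin 2010 §3, twisting primes via Čebotarev; Kramer 1981); kernel-new assembly; beyond-print theorem: no.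
`DoorSupplyAtTwo` AS TYPED (no `Ш[2] = 0`, no `Δ ∉ ℚ²`) needs Mazur–Rubin's full rank-lowering induction (identity primes on square `Δ`; `dim Sel₂ ≥ 3`)
and is NOT proved here. Crux 22136 stays OPEN at (U) 24947 ∧ (CONV₂) 19220/24948.

References: [MazurRubin2010] Prop. 3.3, Cor. 3.4, Lemma 3.5; [KlagsbrunMazurRubin2014] Prop. 47 (ii); [Kramer1981] Props. 3, 6, Thm. 1;
[GrossLMS1991] §1 (p. 235).
-/

set_option linter.dupNamespace false -- tree convention: `Summit.BirchSwinnertonDyer.BirchSwinnertonDyer.Theorems` (summit = sub-problem)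
set_option autoImplicit false

noncomputable section

open scoped Classical

namespace Summit.BirchSwinnertonDyer.BirchSwinnertonDyer.Theorems.GenusKolyTransp

open WeierstrassCurve Field NumberField IsDedekindDomain Function
open Literature.NumberTheory.EllipticCurves Literature.NumberTheory.GaloisRepresentations
open Summit.BirchSwinnertonDyer.Rank1Residual.F1Sign2
open Summit.BirchSwinnertonDyer.Rank1Residual.F1Sign2.EggDoubling (eq_zero_of_two_smul_eq_zero)
open Summit.BirchSwinnertonDyer.Rank1Residual.F1Sign2.TranspositionDoor (TranspAdmissible MeetsNonNormAt)
open Summit.BirchSwinnertonDyer.Rank1Residual.F1Sign2.TwoDoor (TwoTranspAdmissible)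
open Summit.BirchSwinnertonDyer.BirchSwinnertonDyer.Theorems.RankOneAtTwoOneDoor (DoorAdmissible)
open Summit.BirchSwinnertonDyer.BirchSwinnertonDyer.Theorems.GenusKolyArch (eggTwistLawAtTwo_holds)
open Summit.BirchSwinnertonDyer.BirchSwinnertonDyer.Theorems.GenusKolyTwin (exists_silent_prime_heegnerField)

variable (W : WeierstrassCurve ℚ) [W.IsElliptic] [W.IsGloballyMinimal]

/-! ## §40 The three door parameters are door-admissible -/

omit [W.IsElliptic] in
/-- A transposition-admissible `(d, q₀)` is door-admissible. [cite: MazurRubin2010, Def. 3.1] -/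
theorem doorAdmissible_of_transpAdmissible {d : ℤ} {q₀ : ℕ} (h : TranspAdmissible W d q₀) : DoorAdmissible W d := by
  obtain ⟨hneg, hsf, h8, -, -, -, hprimes, hbad⟩ := h
  exact ⟨hneg, hsf, h8, fun q hq hqd ↦ (hprimes q hq hqd).1, hbad⟩

omit [W.IsElliptic] in
/-- A descent-admissible `d` is door-admissible. [cite: MazurRubin2010, Def. 3.1] -/
theorem doorAdmissible_of_descAdmissible {d : ℤ} (h : DescAdmissible W d) : DoorAdmissible W d := by
  obtain ⟨hneg, hsf, h8, hprimes, hbad⟩ := h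
  exact ⟨hneg, hsf, h8, fun q hq hqd ↦ (hprimes q hq hqd).1, hbad⟩

omit [W.IsElliptic] in
/-- A two-transposition-admissible `(d, q₀, q₁)` is door-admissible. [cite: MazurRubin2010, Def. 3.1] -/
theorem doorAdmissible_of_twoTranspAdmissible {d : ℤ} {q₀ q₁ : ℕ} (h : TwoTranspAdmissible W d q₀ q₁) : DoorAdmissible W d := by
  obtain ⟨hneg, hsf, h8, -, -, -, -, -, -, -, hprimes, hbad⟩ := h
  exact ⟨hneg, hsf, h8, fun q hq hqd ↦ (hprimes q hq hqd).1, hbad⟩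

/-! ## §41 The door supply on the slice `{Ш[2] = 0, Δ ∉ ℚ²}` -/

/-- **THE DOOR SUPPLY ON THE SLICE.** `W/ℚ` globally minimal elliptic, `Δ_W ∉ ℚ²`, `E(ℚ)[2] = 0`, Mordell–Weil rank `1`, `Ш(W)[2] = 0`: there is an
imaginary quadratic `K` with `d_K` door-admissible, `#Sel₂(W^{(d_K)}) = 1`, `(d_K, N_W) = 1` and the Heegner hypothesis for `N_W`. Three doors:
`Δ < 0` (`exists_transpAdmissible_door_twistSelmerTwoCard_eq_one`), `Δ > 0 ∧ MeetsEgg` (a silent prime Heegner field `ℚ(√−ℓ)`,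
`GenusKolyTwin.exists_silent_prime_heegnerField`, and T-C `eggTwistLawAtTwo_holds`), `Δ > 0 ∧ ¬MeetsEgg` (`twoTranspositionSupplyAtTwo_holds`;
the only branch using `Δ ∉ ℚ²`). [cite: MazurRubin2010, Prop. 3.3, Cor. 3.4 (i) and Lemma 3.5] [cite: Kramer1981, Prop. 3, Prop. 6] -/
theorem exists_doorAdmissible_twistSelmerTwoCard_eq_one [NeZero (W.conductorNorm ℤ)] (hnsq : ¬ IsSquare W.Δ)
    (hT : NoRationalTwoTorsion W) (hrank : W.mordellWeilRank = 1) (hSha : ShaTwoTrivial W) :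
    ∃ (K : Type) (_ : Field K) (_ : NumberField K),
      IsImaginaryQuadratic K ∧ DoorAdmissible W (NumberField.discr K) ∧ twistSelmerTwoCard W (NumberField.discr K) = 1 ∧
      Nat.Coprime (NumberField.discr K).natAbs (W.conductorNorm ℤ) ∧ SatisfiesHeegnerHypothesis (W.conductorNorm ℤ) K := by
  rcases lt_trichotomy W.Δ 0 with hΔ | hΔ | hΔ
  · -- `Δ < 0`: one transposition prime, door open
    obtain ⟨K, _, _, q₀, _, hK, hadm, -, hcop, hH, hcard⟩ := exists_transpAdmissible_door_twistSelmerTwoCard_eq_one W hΔ hT hrank hSha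
    exact ⟨K, inferInstance, inferInstance, hK, doorAdmissible_of_transpAdmissible W hadm, hcard, hcop, hH⟩
  · exact absurd hΔ W.isUnit_Δ.ne_zero
  · by_cases hegg : MeetsEgg W
    · -- `Δ > 0`, `ε = +1`: a silent prime Heegner field and the egg twist law
      have hsurj : W.HasSurjectiveModNGaloisRep 2 := by
        refine (hasSurjectiveModNGaloisRep_two_iff W).mpr ⟨fun P hP ↦ ?_, hnsq⟩
        have h := eq_zero_of_two_smul_eq_zero W hT P
        convert h (by convert hP)
      obtain ⟨ℓ, -, hℓ, hℓ8, hℓN, -, hdesc, -, K, _, _, hK, hd, -, -, hH, -, -, -⟩ := exists_silent_prime_heegnerField W hΔ hsurj 0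
      have hℓN' : ¬ ℓ ∣ W.conductorNorm ℤ := fun h ↦ by
        have h0 : ((ℓ : ℕ) : ZMod ℓ) = -1 := hℓN ℓ hℓ h (by omega)
        rw [ZMod.natCast_self] at h0
        haveI : Fact (1 < ℓ) := ⟨hℓ.one_lt⟩
        exact one_ne_zero (neg_eq_zero.mp h0.symm)
      refine ⟨K, inferInstance, inferInstance, hK, ?_, ?_, ?_, hH⟩
      · rw [hd]; exact doorAdmissible_of_descAdmissible W hdesc
      · rw [hd]; exact (eggTwistLawAtTwo_holds W hΔ hT hrank hSha _ hdesc).1 hegg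
      · rw [hd, Int.natAbs_neg, Int.natAbs_natCast]
        exact (Nat.Prime.coprime_iff_not_dvd hℓ).mpr hℓN'
    · -- `Δ > 0`, `ε = −1`: two transposition primes
      obtain ⟨K, _, _, q₀, q₁, hK, hadm, hcard, hcop, hH⟩ := twoTranspositionSupplyAtTwo_holds W hΔ hnsq hT hrank hSha hegg
      exact ⟨K, inferInstance, inferInstance, hK, doorAdmissible_of_twoTranspAdmissible W hadm, hcard, hcop, hH⟩

/-- **`RankOneAtTwoOneDoor.DoorSupplyAtTwo` ON THE SLICE**, in the binder order of the fkl line's `Prop` with the two slice hypotheses inserted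
(`¬ IsSquare W.Δ`, `ShaTwoTrivial W`): the displayed supply `hSup` of `…OneDoorAssembly` / `…OneDoorGlue` is a theorem on
`{Ш[2] = 0, Δ ∉ ℚ²}` (in particular on the big-image slice, where `ρ̄_{W,2}` onto forces `Δ ∉ ℚ²`). [cite: MazurRubin2010, Prop. 3.3, Lemma 3.5] -/
theorem doorSupplyAtTwo_on_slice :
    ∀ (W : WeierstrassCurve ℚ) [W.IsElliptic] [W.IsGloballyMinimal] [NeZero (W.conductorNorm ℤ)],
      ¬ IsSquare W.Δ → ShaTwoTrivial W → NoRationalTwoTorsion W → W.mordellWeilRank = 1 →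
      ∃ (K : Type) (_ : Field K) (_ : NumberField K),
        IsImaginaryQuadratic K ∧ DoorAdmissible W (NumberField.discr K) ∧
        twistSelmerTwoCard W (NumberField.discr K) = 1 ∧
        Nat.Coprime (NumberField.discr K).natAbs (W.conductorNorm ℤ) ∧
        SatisfiesHeegnerHypothesis (W.conductorNorm ℤ) K :=
  fun W _ _ _ hnsq hSha hT hrank ↦ exists_doorAdmissible_twistSelmerTwoCard_eq_one W hnsq hT hrank hSha

end Summit.BirchSwinnertonDyer.BirchSwinnertonDyer.Theorems.GenusKolyTransp

end
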